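import Literature.Geometry.Lorentzian.NullCongruenceExpansion
import Literature.Geometry.Lorentzian.TouchingSecondFundamentalForm
import Literature.Geometry.Riemannian.ExpMapLocalDiffeo
import Mathlib.Analysis.Matrix.PosDef
import Mathlib.LinearAlgebra.QuadraticForm.Basic
import Mathlib.Analysis.SpecialFunctions.Log.Deriv
import Literature.Analysis.Calculus.LiouvilleDeterminant
import HarnessLib

/-!
# The congruence of null geodesics from a point (the light cone of a point)

Layer L4 (b) of the proof programme of
`Literature.Geometry.Lorentzian.ChruscielEtAl2001_areaTheorem` (brick B12b): the light cone of a
point `p` — the null geodesics from `p` with initial vectors on the null cone of `T_pM` near a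
given null `ℓ₀` — as an instance of the null normal congruence framework of `NullFocusing.lean` /
`NullCongruenceExpansion.lean` (base map constant `= p`). Hawking–Ellis 1973, §4.5 (proof of
Prop. 4.5.12); O'Neill 1983, Ch. 10, Prop. 10 ff. and proof of Prop. 48.

* `coneVector ℓ₀ N₀ s y = ℓ₀ + ∑ yᵢ sᵢ + ½|y|² N₀`, null for a null frame (`NullConeFrame`:
  `N₀` null with `g(ℓ₀, N₀) = -1`, orthonormal screen `s ⊥ ℓ₀, N₀`; `coneVector_null`,
  `exists_nullConeFrame`); `coneMap p ℓ₀ N₀ s (y, t) = exp_p(t ν(y))`.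
* `NullConeFrame.jacobi_spec` — the Jacobi fields `J_w(t) = ∂_s E(s w, t)|₀` along the central
  generator `σ(t) = exp_p(t ℓ₀)`: Jacobi, differentiable lifts, `J_w(0) = 0`,
  `D_t J_w(0) = ∑ wᵢ sᵢ` (`covariantDerivAlong_const_curve`), `J_w, D_t J_w ⊥ σ'`,
  `J_w(t) = d(E(·, t))₀ w` (linear in `w`, `jacobi_eq_sum`).
* `gram`, `gramDet` (`D`), `expansion` (`θ = D'/(2D)`): `D ≥ 0` (`gramDet_nonneg`);
  `dE_{(0,t)}(w, a) = J_w(t) + a σ'(t)` (`mfderiv_cone_apply`); **`D(t) ≠ 0` iff `dE_{(0,t)}`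
  is injective** (`injective_mfderiv_cone_of_gramDet_ne_zero`,
  `gramDet_ne_zero_of_injective_mfderiv_cone`) — the zeros of `D` are the conjugate points of
  `p` along `σ`; **no conjugate points near the vertex**
  (`exists_injective_mfderiv_cone_near_vertex`, from `exp_p` being a local diffeomorphism at
  `0`); differentiability of `G`, `D` and continuity of `θ` off the conjugate points
  (`hasDerivAt_gramDet`, `continuousAt_expansion`).
* `exists_logDeriv_lt_of_zero` — `θ = D'/(2D)` is unbounded below before a zero of `D`.
* `exists_basis_expansion_eq_sum` — at a non-conjugate parameter, `θ = ∑ₐ g(D_t J_{bₐ}, J_{bₐ})`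
  for a screen basis `b` with `J_b` orthonormal (`exists_basis_orthonormal_of_posDef`,
  basis invariance of `D'/(2D)`, `deriv_det_gram_div_eq_trace`).
* `normalDerivAlong_cone_eq` — the null second fundamental form of the light cone (as the
  hypersurface `E` with generator field `coneVelocity = ∂_t E`) on the screen direction `(w, 0)`
  is `D_t J_w` (symmetry lemma), linking `θ` to the comparison of touching hypersurfaces
  (`TouchingSecondFundamentalForm.lean`).

No named facts (D-0026); the definitions are concrete.

## References

* S. W. Hawking, G. F. R. Ellis, *The large scale structure of space-time* (1973), §4.2, §4.4
  ((4.35)), §4.5 (Prop. 4.5.12 and its proof).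
* B. O'Neill, *Semi-Riemannian geometry* (1983), Ch. 3, Prop. 18; Ch. 5, Lemma 26 ff.; Ch. 10,
  Prop. 10, Cor. 12, Prop. 30, Prop. 48.
* J. M. Lee, *Introduction to Riemannian Manifolds* (2018), Prop. 5.19 (d).
-/

noncomputable section

open Bundle Set Filter Function Matrix
open scoped Manifold ContDiff Topology Matrix

namespace Literature.Geometry.Lorentzian

open Literature.Geometry.Riemannian

universe u

/-! ### Screen algebra: the Gram determinant of vectors orthogonal to a null vector -/

section GramAlgebra

variable {V : Type*} [NormedAddCommGroup V] [NormedSpace ℝ V] (B : V →L[ℝ] V →L[ℝ] ℝ)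

/-- **The Gram matrix of vectors orthogonal to a null vector is positive semidefinite, so its
determinant is nonnegative** (in a Lorentzian scalar product space, `ℓ^⊥` is positive
semidefinite for null `ℓ ≠ 0`, `nonneg_of_orthogonal_null`). [cite: ONeillSemiRiemannian1983, Ch. 5, Lemma 5.28] -/
theorem det_gram_nonneg_of_orthogonal_null (hB : ∀ v w : V, B v w = B w v)
    (hpos : ∀ t w : V, B t t < 0 → B t w = 0 → w ≠ 0 → 0 < B w w)
    {ℓ : V} (hℓ0 : B ℓ ℓ = 0) (hℓ : ℓ ≠ 0) {κ : Type*} [Fintype κ] [DecidableEq κ] {J : κ → V}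
    (hJ : ∀ k, B (J k) ℓ = 0) : 0 ≤ (Matrix.of fun k l ↦ B (J k) (J l)).det := by
  have hpsd : (Matrix.of fun k l ↦ B (J k) (J l)).PosSemidef := by
    rw [Matrix.posSemidef_iff_dotProduct_mulVec]
    refine ⟨?_, fun x ↦ ?_⟩
    · ext k l
      simpa [Matrix.conjTranspose_apply] using hB (J l) (J k)
    · -- `xᵀ G x = B(u, u)` with `u = ∑ xₖ Jₖ ⊥ ℓ`
      set u : V := ∑ k, x k • J k with hu
      have huu : star x ⬝ᵥ ((Matrix.of fun k l ↦ B (J k) (J l)) *ᵥ x) = B u u := by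
        simp only [hu, map_sum, map_smul, FunLike.coe_sum, FunLike.coe_smul, Finset.sum_apply,
          Pi.smul_apply, smul_eq_mul, dotProduct, Matrix.mulVec, Matrix.of_apply, star_trivial,
          Finset.mul_sum]
        exact Finset.sum_congr rfl fun k _ ↦ Finset.sum_congr rfl fun l _ ↦ by
          rw [hB (J k) (J l)]; ring
      have hul : B u ℓ = 0 := by
        simp [hu, map_sum, map_smul, hJ]
      rw [huu]
      exact nonneg_of_orthogonal_null (B := B) hpos hℓ0 hℓ hul
  exact hpsd.det_nonneg

/-- **A nondegenerate screen plus the null direction is linearly independent**: if the vectors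
`Jₖ ⊥ ℓ` (`ℓ` null, nonzero) have a Gram matrix with nonzero determinant, then
`∑ aₖ Jₖ + c ℓ = 0` forces `a = 0` and `c = 0` (pair with `J_l`: `G a = 0`). [folklore] -/
theorem eq_zero_of_sum_smul_add_smul_null_eq_zero (hB : ∀ v w : V, B v w = B w v)
    {ℓ : V} (hℓ : ℓ ≠ 0) {κ : Type*} [Fintype κ] [DecidableEq κ] {J : κ → V}
    (hJ : ∀ k, B (J k) ℓ = 0) (hdet : (Matrix.of fun k l ↦ B (J k) (J l)).det ≠ 0)
    {a : κ → ℝ} {c : ℝ} (h : ∑ k, a k • J k + c • ℓ = 0) : a = 0 ∧ c = 0 := by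
  have hGa : (Matrix.of fun k l ↦ B (J k) (J l)) *ᵥ a = 0 := by
    funext l
    have hl : B (J l) (∑ k, a k • J k + c • ℓ) = 0 := by rw [h, map_zero]
    simp only [map_add, map_sum, map_smul, smul_eq_mul, hJ l, mul_zero, add_zero] at hl
    simp only [Matrix.mulVec, dotProduct, Matrix.of_apply, Pi.zero_apply]
    rw [← hl]
    exact Finset.sum_congr rfl fun k _ ↦ by rw [hB (J l) (J k), mul_comm]
  have ha : a = 0 := by
    by_contra ha
    exact hdet (Matrix.exists_mulVec_eq_zero_iff.1 ⟨a, ha, hGa⟩)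
  refine ⟨ha, ?_⟩
  rw [ha] at h
  simp only [Pi.zero_apply, zero_smul, Finset.sum_const_zero, zero_add] at h
  by_contra hc
  exact hℓ ((smul_eq_zero.1 h).resolve_left hc)

end GramAlgebra

/-! ### Blow-up of the logarithmic derivative at a zero -/

/-- **`D'/(2D) → -∞` at the first zero.** If `D > 0` on `(r - δ, r)` with derivative `D'`
there, `D` is continuous at `r` and `D(r) = 0`, then `D'/(2D)` is unbounded below on
`(r - δ, r)`: otherwise `(log D)' ≥ -2K` there and `D` would stay bounded away from `0` up to
`r`. This is how the expansion `θ = D'/(2D)` of a null congruence diverges to `-∞` at a focal /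
conjugate point (Hawking–Ellis 1973, §4.4, discussion after (4.35); O'Neill 1983, Ch. 10, proof
of Prop. 10.43). [cite: HawkingEllis1973CUP, §4.4] -/
theorem exists_logDeriv_lt_of_zero {D D' : ℝ → ℝ} {r δ : ℝ} (hδ : 0 < δ)
    (hd : ∀ t ∈ Ioo (r - δ) r, HasDerivAt D (D' t) t) (hpos : ∀ t ∈ Ioo (r - δ) r, 0 < D t)
    (hcont : ContinuousAt D r) (hr : D r = 0) (K : ℝ) :
    ∃ t ∈ Ioo (r - δ) r, D' t / (2 * D t) < -K := by
  by_contra hcon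
  push Not at hcon
  -- `φ = log D + 2 K t` is nondecreasing on `(r - δ, r)`
  set φ : ℝ → ℝ := fun t ↦ Real.log (D t) + 2 * K * t with hφ
  have hφd : ∀ t ∈ Ioo (r - δ) r, HasDerivAt φ (D' t / D t + 2 * K) t := fun t ht ↦ by
    have h1 := (hd t ht).log (hpos t ht).ne'
    have h2 : HasDerivAt (fun t : ℝ ↦ 2 * K * t) (2 * K) t := by
      simpa using (hasDerivAt_id t).const_mul (2 * K)
    exact h1.add h2
  have hmono : MonotoneOn φ (Ioo (r - δ) r) := by
    refine monotoneOn_of_deriv_nonneg (convex_Ioo _ _)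
      (fun t ht ↦ (hφd t ht).continuousAt.continuousWithinAt) ?_ ?_
    · rw [interior_Ioo]
      exact fun t ht ↦ (hφd t ht).differentiableAt.differentiableWithinAt
    · rw [interior_Ioo]
      intro t ht
      rw [(hφd t ht).deriv]
      have h := hcon t ht
      have hDt := hpos t ht
      have : -K ≤ D' t / (2 * D t) := h
      rw [le_div_iff₀ (by positivity)] at this
      have h' : -2 * K ≤ D' t / D t := by
        rw [le_div_iff₀ hDt]; linarith
      linarith
  -- lower bound for `D` on `[t₀, r)`, `t₀ = r - δ/2`
  set t₀ : ℝ := r - δ / 2 with ht₀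
  have ht₀m : t₀ ∈ Ioo (r - δ) r := ⟨by rw [ht₀]; linarith, by rw [ht₀]; linarith⟩
  set c : ℝ := φ t₀ - 2 * |K| * (|r| + δ) - 2 * K * r with hc
  have hbound : ∀ t ∈ Ico t₀ r, Real.exp (φ t₀ - 2 * K * t) ≤ D t := by
    intro t ht
    have htm : t ∈ Ioo (r - δ) r := ⟨lt_of_lt_of_le ht₀m.1 ht.1, ht.2⟩
    have hle : φ t₀ ≤ φ t := hmono ht₀m htm ht.1
    have hlog : φ t₀ - 2 * K * t ≤ Real.log (D t) := by
      simp only [hφ] at hle ⊢; linarith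
    calc Real.exp (φ t₀ - 2 * K * t) ≤ Real.exp (Real.log (D t)) := Real.exp_le_exp.2 hlog
      _ = D t := Real.exp_log (hpos t htm)
  -- a uniform positive lower bound near `r` from the left
  set mlb : ℝ := Real.exp (φ t₀ - 2 * |K| * (|r| + 1) - |2 * K * r|) with hmlb
  have hmlb_pos : 0 < mlb := Real.exp_pos _
  have hev : ∀ᶠ t in 𝓝[<] r, mlb ≤ D t := by
    have hIco : Ico t₀ r ∈ 𝓝[<] r := Ico_mem_nhdsLT ht₀m.2
    have hnear : ∀ᶠ t in 𝓝[<] r, |t - r| < 1 := by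
      have : Ioo (r - 1) r ∈ 𝓝[<] r := Ioo_mem_nhdsLT (by linarith)
      filter_upwards [this] with t ht
      rw [abs_lt]; constructor <;> linarith [ht.1, ht.2]
    filter_upwards [hIco, hnear] with t ht htr
    refine le_trans ?_ (hbound t ht)
    rw [hmlb]
    apply Real.exp_le_exp.2
    have h1 : 2 * K * t = 2 * K * r + 2 * K * (t - r) := by ring
    have h2 : |2 * K * (t - r)| ≤ 2 * |K| * (|r| + 1) := by
      rw [abs_mul, abs_mul, abs_two]
      have : |t - r| ≤ |r| + 1 := by linarith [abs_nonneg r]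
      nlinarith [abs_nonneg K, abs_nonneg (t - r)]
    have h3 : 2 * K * (t - r) ≤ |2 * K * (t - r)| := le_abs_self _
    have h4 : 2 * K * r ≤ |2 * K * r| := le_abs_self _
    linarith
  -- contradiction with `D r = 0` by continuity from the left
  have hlim : Tendsto D (𝓝[<] r) (𝓝 (D r)) := hcont.tendsto.mono_left nhdsWithin_le_nhds
  have hge : mlb ≤ D r := ge_of_tendsto hlim hev
  rw [hr] at hge
  exact absurd hge (not_le.2 hmlb_pos)

/-! ### Orthonormal bases for a positive definite symmetric bilinear form -/

/-- **A positive definite symmetric bilinear form on a finite-dimensional real space has an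
orthonormal basis** (an orthogonal basis exists for any symmetric form,
`LinearMap.BilinForm.exists_orthogonal_basis`; normalise). [folklore] -/
theorem exists_basis_orthonormal_of_posDef {W : Type*} [AddCommGroup W] [Module ℝ W]
    [FiniteDimensional ℝ W] (B : LinearMap.BilinForm ℝ W) (hB : ∀ v w, B v w = B w v)
    (hpos : ∀ w, w ≠ 0 → 0 < B w w) :
    ∃ b : Module.Basis (Fin (Module.finrank ℝ W)) ℝ W,
      ∀ i j, B (b i) (b j) = if i = j then 1 else 0 := by
  have hB' : LinearMap.IsSymm B := ⟨fun v w ↦ hB v w⟩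
  obtain ⟨v, hv⟩ := LinearMap.BilinForm.exists_orthogonal_basis hB'
  have hvpos : ∀ i, 0 < B (v i) (v i) := fun i ↦ hpos _ (v.ne_zero i)
  set c : Fin (Module.finrank ℝ W) → ℝ := fun i ↦ (Real.sqrt (B (v i) (v i)))⁻¹ with hc
  have hcne : ∀ i, c i ≠ 0 := fun i ↦ inv_ne_zero (Real.sqrt_pos.2 (hvpos i)).ne'
  refine ⟨v.isUnitSMul (fun i ↦ (isUnit_iff_ne_zero.2 (hcne i))), fun i j ↦ ?_⟩
  rw [Module.Basis.isUnitSMul_apply, Module.Basis.isUnitSMul_apply]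
  simp only [map_smul, LinearMap.smul_apply, smul_eq_mul]
  by_cases hij : i = j
  · subst hij
    simp only [if_true, hc]
    have hs : Real.sqrt (B (v i) (v i)) ^ 2 = B (v i) (v i) := Real.sq_sqrt (hvpos i).le
    have hsne : Real.sqrt (B (v i) (v i)) ≠ 0 := (Real.sqrt_pos.2 (hvpos i)).ne'
    set q := Real.sqrt (B (v i) (v i)) with hq
    rw [← hs]
    field_simp
  · rw [if_neg hij, hv hij, mul_zero, mul_zero]

section Cone

variable {E : Type u} [NormedAddCommGroup E] [NormedSpace ℝ E] [FiniteDimensional ℝ E]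
  [CompleteSpace E] {M : Type*} [TopologicalSpace M] [ChartedSpace E M] [IsManifold 𝓘(ℝ, E) ∞ M]
  [T2Space M] {n : ℕ∞ω} [Fact (1 ≤ n)] (g : LorentzianMetric 𝓘(ℝ, E) n M) [g.HasLeviCivita]
  [CovariantDerivative.ContMDiffCovariantDerivative g.leviCivita 1]
  [CovariantDerivative.ContMDiffCovariantDerivative g.leviCivita (⊤ : ℕ∞)]
  {m : ℕ}

/-- **The null vectors of the light cone near `ℓ₀`, parametrised by the screen.** For null
`ℓ₀, N₀` with `g(ℓ₀, N₀) = -1` and an orthonormal screen `s₁, …, s_m ⊥ ℓ₀, N₀`, the vector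
`ν(y) = ℓ₀ + ∑ yᵢ sᵢ + ½ (∑ yᵢ²) N₀` is null for every `y` (`val_coneVector_self`): a smooth
parametrisation of the null cone of `T_pM` near `ℓ₀` by `ℝ^m` (Hawking–Ellis 1973, §4.2,
pseudo-orthonormal bases; O'Neill 1983, Ch. 5, Lemma 26 ff.). [cite: HawkingEllis1973CUP, §4.2] -/
def coneVector (ℓ₀ N₀ : E) (s : Fin m → E) (y : Fin m → ℝ) : E :=
  ℓ₀ + ∑ i, y i • s i + ((∑ i, y i ^ 2) / 2) • N₀

/-- **The light-cone map of `p`**: `(y, t) ↦ exp_p(t ν(y))`, the congruence of null geodesics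
from `p` with initial null vectors `ν(y)` (`coneVector`); its image near a generator is the null
cone `∂J⁺(p)` there (Hawking–Ellis 1973, §4.5, proof of Prop. 4.5.12; O'Neill 1983, Ch. 10, proof
of Prop. 48 and Ch. 14, Lemma 3). [cite: HawkingEllis1973CUP, §4.5, Prop. 4.5.12 (proof)] -/
def coneMap (p : M) (ℓ₀ N₀ : E) (s : Fin m → E) (q : (Fin m → ℝ) × ℝ) : M :=
  expMap g.leviCivita p ((q.2 • coneVector ℓ₀ N₀ s q.1 : E) : TangentSpace 𝓘(ℝ, E) p)

/-- **A null frame at `p` adapted to the null vector `ℓ₀`**: a second null vector `N₀` with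
`g(ℓ₀, N₀) = -1` and an orthonormal screen `s₁, …, s_m` orthogonal to both (Hawking–Ellis 1973,
§4.2, pseudo-orthonormal basis `E₁, …, E_{n-2}, E_{n-1} = N, E_n = K`; O'Neill 1983, Ch. 5,
Lemma 26 ff.). The data of the light-cone parametrisation `coneVector` / `coneMap`.
[cite: HawkingEllis1973CUP, §4.2] -/
structure NullConeFrame (p : M) (m : ℕ) where
  /-- the distinguished null vector (the generator direction) -/
  ℓ₀ : E
  /-- the transverse null vector, `g(ℓ₀, N₀) = -1` -/
  N₀ : E
  /-- the orthonormal screen -/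
  s : Fin m → E
  null_ℓ₀ : g.val p ℓ₀ ℓ₀ = 0
  null_N₀ : g.val p N₀ N₀ = 0
  cross : g.val p ℓ₀ N₀ = -1
  screen_ℓ₀ : ∀ i, g.val p (s i) ℓ₀ = 0
  screen_N₀ : ∀ i, g.val p (s i) N₀ = 0
  orthonormal : ∀ i j, g.val p (s i) (s j) = if i = j then 1 else 0

namespace NullConeFrame

variable {g} {p : M} (F : NullConeFrame g p m)

omit [FiniteDimensional ℝ E] [CompleteSpace E] [T2Space M] [Fact (1 ≤ n)] [g.HasLeviCivita]
  [CovariantDerivative.ContMDiffCovariantDerivative g.leviCivita 1]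
  [CovariantDerivative.ContMDiffCovariantDerivative g.leviCivita (⊤ : ℕ∞)] in
/-- The generator direction of a null frame is nonzero (`g(ℓ₀, N₀) = -1`). [folklore] -/
theorem ℓ₀_ne_zero : F.ℓ₀ ≠ 0 := by
  intro h
  have h1 : g.val p F.ℓ₀ F.N₀ = -1 := F.cross
  have h2 : g.val p F.ℓ₀ F.N₀ = 0 := by
    have h' := congrArg (fun v : E ↦ (g.val p v F.N₀ : ℝ)) h
    have h0 : (g.val p (0 : E) F.N₀ : ℝ) = 0 := by
      have hz : (g.val p (0 : TangentSpace 𝓘(ℝ, E) p)) = 0 := (g.val p).map_zero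
      change (g.val p (0 : TangentSpace 𝓘(ℝ, E) p)) F.N₀ = 0
      rw [hz]; rfl
    exact h'.trans h0
  rw [h2] at h1
  norm_num at h1

/-- The null generators' initial vectors `ν(y)` of the frame. [cite: HawkingEllis1973CUP, §4.5] -/
abbrev ν (y : Fin m → ℝ) : E := coneVector F.ℓ₀ F.N₀ F.s y

/-- The light-cone map `(y, t) ↦ exp_p(t ν(y))` of the frame. [cite: HawkingEllis1973CUP, §4.5] -/
abbrev cone (q : (Fin m → ℝ) × ℝ) : M := coneMap g p F.ℓ₀ F.N₀ F.s q

/-- The central generator `σ(t) = exp_p(t ℓ₀)` (as `E(0, t)`). [cite: HawkingEllis1973CUP, §4.5] -/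
abbrev gen (t : ℝ) : M := F.cone (0, t)

/-- **The Jacobi field `J_w` of the light cone along the central generator**,
`J_w(t) = ∂_s E(s w, t)|_{s = 0}` (read in the model space `E`). [cite: HawkingEllis1973CUP, §4.5] -/
def jacobi (w : Fin m → ℝ) (t : ℝ) : E :=
  velocity 𝓘(ℝ, E) (fun s' ↦ F.cone (curveThrough 𝓘(ℝ, Fin m → ℝ) (0 : Fin m → ℝ) w s', t)) 0

/-- **The Gram matrix `G_{kl}(t) = g(J_{e_k}(t), J_{e_l}(t))`** of the Jacobi fields of the
standard screen basis along the central generator. [cite: HawkingEllis1973CUP, §4.5] -/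
def gram (t : ℝ) : Matrix (Fin m) (Fin m) ℝ :=
  Matrix.of fun k l ↦ g.val (F.gen t) (F.jacobi (Pi.single k 1) t) (F.jacobi (Pi.single l 1) t)

/-- **The Gram determinant `D(t) = det G(t)`** — the squared area element of the light cone
along the central generator; its zeros in `t > 0` are the points conjugate to `p`
(`gramDet_eq_zero_iff`). Hawking–Ellis 1973, §4.5 (proof of Prop. 4.5.12).
[cite: HawkingEllis1973CUP, §4.5, Prop. 4.5.12 (proof)] -/
def gramDet (t : ℝ) : ℝ := (F.gram t).det

/-- The velocity `σ'(t)` of the central generator, read in the model space `E`. [folklore] -/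
def genVelocity (t : ℝ) : E := velocity 𝓘(ℝ, E) F.gen t

end NullConeFrame

omit [FiniteDimensional ℝ E] [CompleteSpace E] in
/-- At the origin of the screen the cone vector is `ℓ₀`. [folklore] -/
@[simp] theorem coneVector_zero (ℓ₀ N₀ : E) (s : Fin m → E) : coneVector ℓ₀ N₀ s 0 = ℓ₀ := by
  simp [coneVector]

omit [FiniteDimensional ℝ E] [CompleteSpace E] in
/-- The cone vector is a smooth (polynomial) function of the screen coordinates. [folklore] -/
theorem contDiff_coneVector (ℓ₀ N₀ : E) (s : Fin m → E) :
    ContDiff ℝ ∞ (coneVector ℓ₀ N₀ s) := by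
  unfold coneVector
  refine (contDiff_const.add ?_).add ?_
  · exact ContDiff.sum fun i _ ↦ ((contDiff_apply ℝ ℝ i).smul contDiff_const)
  · refine ContDiff.smul ?_ contDiff_const
    exact (ContDiff.sum fun i _ ↦ (contDiff_apply ℝ ℝ i).pow 2).div_const 2

omit [FiniteDimensional ℝ E] [CompleteSpace E] in
/-- **The differential of the cone vector at the origin is the screen embedding**:
`dν₀(w) = ∑ wᵢ sᵢ`. [folklore] -/
theorem hasFDerivAt_coneVector_zero (ℓ₀ N₀ : E) (s : Fin m → E) :
    HasFDerivAt (coneVector ℓ₀ N₀ s)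
      (∑ i, (ContinuousLinearMap.proj (R := ℝ) (φ := fun _ : Fin m ↦ ℝ) i).smulRight (s i)) 0 := by
  have h1 : ∀ i, HasFDerivAt (fun y : Fin m → ℝ ↦ y i • s i)
      ((ContinuousLinearMap.proj (R := ℝ) (φ := fun _ : Fin m ↦ ℝ) i).smulRight (s i)) 0 :=
    fun i ↦ (hasFDerivAt_apply (𝕜 := ℝ) i (0 : Fin m → ℝ)).smul_const (s i)
  have h2 : ∀ i, HasFDerivAt (fun y : Fin m → ℝ ↦ y i ^ 2) (0 : (Fin m → ℝ) →L[ℝ] ℝ) 0 := by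
    intro i
    have h : HasFDerivAt (fun y : Fin m → ℝ ↦ y i) (ContinuousLinearMap.proj i) 0 :=
      hasFDerivAt_apply (𝕜 := ℝ) i (0 : Fin m → ℝ)
    simpa using h.pow 2
  have hS : HasFDerivAt (fun y : Fin m → ℝ ↦ ∑ i, y i • s i)
      (∑ i, (ContinuousLinearMap.proj (R := ℝ) (φ := fun _ : Fin m ↦ ℝ) i).smulRight (s i)) 0 :=
    HasFDerivAt.fun_sum fun i _ ↦ h1 i
  have hQ : HasFDerivAt (fun y : Fin m → ℝ ↦ ∑ i, y i ^ 2) (0 : (Fin m → ℝ) →L[ℝ] ℝ) 0 := by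
    have h := HasFDerivAt.fun_sum (u := Finset.univ) fun i _ ↦ h2 i
    simpa using h
  have hQ' : HasFDerivAt (fun y : Fin m → ℝ ↦ ((∑ i, y i ^ 2) / 2) • N₀)
      (0 : (Fin m → ℝ) →L[ℝ] E) 0 := by
    have h := (hQ.mul_const (2 : ℝ)⁻¹).smul_const N₀
    simpa [div_eq_mul_inv] using h
  have h := ((hasFDerivAt_const ℓ₀ (0 : Fin m → ℝ)).add hS).add hQ'
  simp only [zero_add, add_zero] at h
  exact h

omit [FiniteDimensional ℝ E] [CompleteSpace E] in
/-- **The cone vectors are null.** For a symmetric bilinear form `B` with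
`B(ℓ₀, ℓ₀) = B(N₀, N₀) = 0`, `B(ℓ₀, N₀) = -1` and an orthonormal screen `sᵢ ⊥ ℓ₀, N₀`:
`B(ν(y), ν(y)) = |y|² + 2 · ½|y|² · B(ℓ₀, N₀) = 0` (stated for the model space; instantiate
`B := g_p`). [cite: HawkingEllis1973CUP, §4.2] -/
theorem coneVector_null (B : E →L[ℝ] E →L[ℝ] ℝ) (hB : ∀ v w, B v w = B w v) {ℓ₀ N₀ : E}
    {s : Fin m → E} (hℓ : B ℓ₀ ℓ₀ = 0) (hN : B N₀ N₀ = 0) (hℓN : B ℓ₀ N₀ = -1)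
    (hsℓ : ∀ i, B (s i) ℓ₀ = 0) (hsN : ∀ i, B (s i) N₀ = 0)
    (hss : ∀ i j, B (s i) (s j) = if i = j then 1 else 0) (y : Fin m → ℝ) :
    B (coneVector ℓ₀ N₀ s y) (coneVector ℓ₀ N₀ s y) = 0 := by
  set S : E := ∑ i, y i • s i with hS
  set c : ℝ := (∑ i, y i ^ 2) / 2 with hc
  have hSℓ : B S ℓ₀ = 0 := by
    simp [hS, map_sum, map_smul, hsℓ]
  have hSN : B S N₀ = 0 := by
    simp [hS, map_sum, map_smul, hsN]
  have hSS : B S S = ∑ i, y i ^ 2 := by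
    simp only [hS, map_sum, map_smul, FunLike.coe_sum, FunLike.coe_smul, Finset.sum_apply,
      Pi.smul_apply, smul_eq_mul, hss]
    simp [pow_two]
  have hℓS : B ℓ₀ S = 0 := by rw [hB, hSℓ]
  have hNS : B N₀ S = 0 := by rw [hB, hSN]
  have hNℓ : B N₀ ℓ₀ = -1 := by rw [hB, hℓN]
  show B (ℓ₀ + S + c • N₀) (ℓ₀ + S + c • N₀) = 0
  simp only [map_add, map_smul, _root_.add_apply, FunLike.coe_smul,
    Pi.smul_apply, smul_eq_mul, hℓ, hN, hSS, hSℓ, hSN, hℓS, hNS, hNℓ, hℓN]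
  rw [hc]
  ring

omit [FiniteDimensional ℝ E] [CompleteSpace E] [T2Space M] [Fact (1 ≤ n)]
  [g.HasLeviCivita] [CovariantDerivative.ContMDiffCovariantDerivative g.leviCivita 1]
  [CovariantDerivative.ContMDiffCovariantDerivative g.leviCivita (⊤ : ℕ∞)] in
/-- The section `y ↦ (p, ν(y)) ∈ TM` of initial data of the light cone is smooth (a smooth map
into a single fibre). [folklore] -/
theorem contMDiff_coneVector_totalSpace (p : M) (ℓ₀ N₀ : E) (s : Fin m → E) :
    ContMDiff 𝓘(ℝ, Fin m → ℝ) 𝓘(ℝ, E).tangent ∞ (fun y : Fin m → ℝ ↦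
      (TotalSpace.mk' E p ((coneVector ℓ₀ N₀ s y : E) : TangentSpace 𝓘(ℝ, E) p) :
        TangentBundle 𝓘(ℝ, E) M)) := by
  intro y
  rw [contMDiffAt_totalSpace]
  refine ⟨contMDiffAt_const, ?_⟩
  have h : (fun y' : Fin m → ℝ ↦ (trivializationAt E (TangentSpace 𝓘(ℝ, E)) p
      (TotalSpace.mk' E p ((coneVector ℓ₀ N₀ s y' : E) : TangentSpace 𝓘(ℝ, E) p) :
        TangentBundle 𝓘(ℝ, E) M)).2) = coneVector ℓ₀ N₀ s := by
    funext y'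
    exact trivializationAt_snd_of_eq rfl _
  rw [h]
  exact (contDiff_coneVector ℓ₀ N₀ s).contMDiff y

omit [FiniteDimensional ℝ E] [CompleteSpace E] [T2Space M] [Fact (1 ≤ n)]
  [g.HasLeviCivita] [CovariantDerivative.ContMDiffCovariantDerivative g.leviCivita 1]
  [CovariantDerivative.ContMDiffCovariantDerivative g.leviCivita (⊤ : ℕ∞)] in
/-- The initial data of the light cone are trivially normal to the (constant) base map. [folklore] -/
theorem isNormalTo_const_coneVector (p : M) (ℓ₀ N₀ : E) (s : Fin m → E) :
    g.IsNormalTo 𝓘(ℝ, Fin m → ℝ) (fun _ : Fin m → ℝ ↦ p)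
      (fun y ↦ ((coneVector ℓ₀ N₀ s y : E) : TangentSpace 𝓘(ℝ, E) p)) := by
  intro y v
  have h : mfderiv 𝓘(ℝ, Fin m → ℝ) 𝓘(ℝ, E) (fun _ : Fin m → ℝ ↦ p) y = 0 := mfderiv_const
  rw [h, _root_.zero_apply, map_zero]

/-! ### Covariant derivatives along a constant curve -/

omit [T2Space M] [Fact (1 ≤ n)] [g.HasLeviCivita]
  [CovariantDerivative.ContMDiffCovariantDerivative g.leviCivita 1]
  [CovariantDerivative.ContMDiffCovariantDerivative g.leviCivita (⊤ : ℕ∞)] [CompleteSpace E] in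
/-- **Along a constant curve the covariant derivative is the ordinary derivative**: for a
differentiable curve `W` in the single fibre `T_xM = E`, `D_t W = W'` (the chart formula
`D_t Z = Ż + Γ(γ', Z)` with `γ' = 0`; O'Neill 1983, Ch. 3, Prop. 18 (3.6)).
[cite: ONeillSemiRiemannian1983, Ch. 3, Prop. 18] -/
theorem covariantDerivAlong_const_curve
    (cov : CovariantDerivative 𝓘(ℝ, E) E (TangentSpace 𝓘(ℝ, E) : M → Type _))
    (hcov : cov.IsLocallyContMDiff ∞) (x : M) {W : ℝ → E} {t : ℝ} (hW : DifferentiableAt ℝ W t) :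
    (covariantDerivAlong cov (fun _ : ℝ ↦ x) (fun t' ↦ (W t' : TangentSpace 𝓘(ℝ, E) x)) t : E) =
      deriv W t := by
  have hb : x ∈ (trivializationAt E (TangentSpace 𝓘(ℝ, E)) x).baseSet :=
    FiberBundle.mem_baseSet_trivializationAt' x
  have hsymm : ∀ v : E, (trivializationAt E (TangentSpace 𝓘(ℝ, E)) x).symmL ℝ x v = v := fun v ↦ by
    have h := (trivializationAt E (TangentSpace 𝓘(ℝ, E)) x).symmL_continuousLinearMapAt
      (R := ℝ) hb v
    rw [continuousLinearMapAt_of_eq (E := E) (M := M) (x₁ := x) rfl v] at h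
    exact h
  have hfield : ∀ᶠ t' in 𝓝 t, (W t' : TangentSpace 𝓘(ℝ, E) x) =
      (trivializationAt E (TangentSpace 𝓘(ℝ, E)) x).symmL ℝ x (W t') :=
    Eventually.of_forall fun t' ↦ (hsymm (W t')).symm
  rw [covariantDerivAlong_congr_field cov hfield]
  have hformula := continuousLinearMapAt_covariantDerivAlong_symmL_Γmat cov hcov x
    (γ := fun _ : ℝ ↦ x) (t := t) (mem_chart_source E x) mdifferentiableAt_const hW
  have hvel : (velocity 𝓘(ℝ, E) (fun _ : ℝ ↦ x) t : E) = 0 := by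
    simp [velocity, mfderiv_const]
  have h0 : ((trivializationAt E (TangentSpace 𝓘(ℝ, E)) x
      ⟨x, velocity 𝓘(ℝ, E) (fun _ : ℝ ↦ x) t⟩).2 : E) = 0 :=
    (trivializationAt_snd_of_eq (x₁ := x) rfl _).trans hvel
  rw [h0] at hformula
  have hΓ : Γmat cov hcov x x (0 : E) = 0 := by
    have h := Γmat_smul cov hcov x x 0 (0 : E)
    rwa [zero_smul, zero_smul] at h
  rw [hΓ, _root_.zero_apply, add_zero] at hformula
  rw [← continuousLinearMapAt_of_eq (E := E) (M := M) (x₁ := x) (p := x) rfl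
    (covariantDerivAlong cov (fun _ : ℝ ↦ x)
      (fun t' ↦ (trivializationAt E (TangentSpace 𝓘(ℝ, E)) x).symmL ℝ x (W t')) t : E)]
  exact hformula

/-! ### The Jacobi fields of the light cone along the generator `σ(t) = exp_p(t ℓ₀)` -/

variable {g} in
/-- **The Jacobi package of the light cone of `p` along the central generator.** For the cone
data (`ℓ₀, N₀` null, `g(ℓ₀, N₀) = -1`, orthonormal screen `s`) and `w : ℝ^m`,
`t ∈ dom σ` (`σ(t) = exp_p(t ν(0))`, `ν(0) = ℓ₀`), the field
`J_w(t) = ∂_s E(s w, t)|_{s=0}` along `σ` is a Jacobi field with differentiable lifts,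
**vanishes at the vertex** (`J_w(0) = 0`), has **initial covariant derivative the screen vector
`∑ wᵢ sᵢ`**, is orthogonal to `σ'` together with `D_t J_w`, and equals the differential of the
slice `E(·, t)` at `0` applied to `w` (`nullJacobi_spec` for the constant base map;
`covariantDerivAlong_const_curve`, `hasFDerivAt_coneVector_zero`). Hawking–Ellis 1973, §4.5
(Jacobi fields of the null geodesics from `p`); O'Neill 1983, Ch. 10, Prop. 10 and Lemma 15.
[cite: HawkingEllis1973CUP, §4.5] [cite: ONeillSemiRiemannian1983, Ch. 10, Prop. 10] -/
theorem NullConeFrame.jacobi_spec {p : M} (F : NullConeFrame g p m)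
    (hreg : g.leviCivita.IsLocallyContMDiff ∞) (hreg₁ : g.leviCivita.IsLocallyContMDiff 1)
    (w : Fin m → ℝ) {t : ℝ}
    (ht : t ∈ maximalGeodesicDomain g.leviCivita p ((F.ν 0 : E) : TangentSpace 𝓘(ℝ, E) p)) :
    let γ : ℝ → M := F.gen
    let J : Π t : ℝ, TangentSpace 𝓘(ℝ, E) (γ t) := fun t ↦ F.jacobi w t
    IsJacobiFieldAlongOn g.toPseudoRiemannianMetric γ J {t} ∧
    MDifferentiableAt 𝓘(ℝ, ℝ) 𝓘(ℝ, E).tangent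
      (fun t ↦ (TotalSpace.mk' E (γ t) (J t) : TangentBundle 𝓘(ℝ, E) M)) t ∧
    MDifferentiableAt 𝓘(ℝ, ℝ) 𝓘(ℝ, E).tangent (fun t ↦ (TotalSpace.mk' E (γ t)
      (covariantDerivAlong g.leviCivita γ J t) : TangentBundle 𝓘(ℝ, E) M)) t ∧
    g.val (γ t) (J t) (velocity 𝓘(ℝ, E) γ t) = 0 ∧
    g.val (γ t) (covariantDerivAlong g.leviCivita γ J t) (velocity 𝓘(ℝ, E) γ t) = 0 ∧
    (J 0 : E) = 0 ∧
    (covariantDerivAlong g.leviCivita γ J 0 : E) = ∑ i, w i • F.s i ∧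
    J t = mfderiv 𝓘(ℝ, Fin m → ℝ) 𝓘(ℝ, E) (fun y ↦ F.cone (y, t)) 0 w := by
  intro γ J
  have hL := contMDiff_coneVector_totalSpace (M := M) p F.ℓ₀ F.N₀ F.s
  have hnull : ∀ y : Fin m → ℝ, g.val p ((coneVector F.ℓ₀ F.N₀ F.s y : E) :
      TangentSpace 𝓘(ℝ, E) p) ((coneVector F.ℓ₀ F.N₀ F.s y : E) : TangentSpace 𝓘(ℝ, E) p) = 0 :=
    fun y ↦ coneVector_null (E := E) (B := g.val p) (fun v w ↦ g.symm p v w)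
      F.null_ℓ₀ F.null_N₀ F.cross F.screen_ℓ₀ F.screen_N₀ F.orthonormal y
  have hLn := isNormalTo_const_coneVector g p F.ℓ₀ F.N₀ F.s
  obtain ⟨hjac, hJd, hDJd, hJperp, hDJperp, hJ0, hDJ0, hJt⟩ :=
    nullJacobi_spec g hreg₁ hL hnull hLn (0 : Fin m → ℝ) w ht
  refine ⟨hjac, hJd, hDJd, hJperp, hDJperp, ?_, ?_, hJt⟩
  · -- `J 0 = d(const)(w) = 0`
    refine hJ0.trans ?_
    rw [mfderiv_const]
    rfl
  · -- `D_t J(0) = D_s ν(s w)|₀ = dν₀(w) = ∑ wᵢ sᵢ`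
    refine hDJ0.trans ?_
    have hcurve : ∀ s', curveThrough 𝓘(ℝ, Fin m → ℝ) (0 : Fin m → ℝ) w s' = s' • w := fun s' ↦ by
      simp [curveThrough]
    show (covariantDerivAlong g.leviCivita (fun _ : ℝ ↦ p) (fun s' ↦
      ((coneVector F.ℓ₀ F.N₀ F.s (curveThrough 𝓘(ℝ, Fin m → ℝ) (0 : Fin m → ℝ) w s') : E) :
        TangentSpace 𝓘(ℝ, E) p)) 0 : E) = _
    have hW : HasDerivAt (fun s' : ℝ ↦ coneVector F.ℓ₀ F.N₀ F.s
        (curveThrough 𝓘(ℝ, Fin m → ℝ) (0 : Fin m → ℝ) w s')) (∑ i, w i • F.s i) 0 := by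
      have hline : HasDerivAt (fun s' : ℝ ↦ curveThrough 𝓘(ℝ, Fin m → ℝ) (0 : Fin m → ℝ) w s')
          w 0 := by
        have h : HasDerivAt (fun s' : ℝ ↦ s' • w) ((1 : ℝ) • w) 0 := (hasDerivAt_id' (0 : ℝ)).smul_const w
        rw [one_smul] at h
        exact h.congr_of_eventuallyEq (Eventually.of_forall hcurve)
      have h0 : curveThrough 𝓘(ℝ, Fin m → ℝ) (0 : Fin m → ℝ) w 0 = 0 := by rw [hcurve, zero_smul]
      have hν := hasFDerivAt_coneVector_zero F.ℓ₀ F.N₀ F.s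
      rw [← h0] at hν
      have h := hν.comp_hasDerivAt (0 : ℝ) hline
      have hsum : (∑ i, (ContinuousLinearMap.proj (R := ℝ) (φ := fun _ : Fin m ↦ ℝ) i).smulRight
          (F.s i)) w = ∑ i, w i • F.s i := by
        simp
      rw [hsum] at h
      exact h
    rw [covariantDerivAlong_const_curve g.leviCivita hreg p hW.differentiableAt, hW.deriv]

/-! ### The central generator: geodesic, null, nonvanishing velocity -/

namespace NullConeFrame

variable {g} {p : M} (F : NullConeFrame g p m)

omit [CompleteSpace E] [T2Space M] [CovariantDerivative.ContMDiffCovariantDerivative g.leviCivita 1]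
  [CovariantDerivative.ContMDiffCovariantDerivative g.leviCivita (⊤ : ℕ∞)] [Fact (1 ≤ n)] in
/-- The light-cone map in the form of the normal exponential map of the constant base map
(definitional unfolding). [folklore] -/
theorem cone_eq : F.cone = fun q : (Fin m → ℝ) × ℝ ↦
    expMap g.leviCivita p (q.2 • ((F.ν q.1 : E) : TangentSpace 𝓘(ℝ, E) p)) := rfl

omit [CovariantDerivative.ContMDiffCovariantDerivative g.leviCivita (⊤ : ℕ∞)] in
/-- **The central generator is the maximal geodesic with initial velocity `ℓ₀`**; it is null with
nowhere-vanishing velocity on its domain. [cite: ONeillSemiRiemannian1983, Ch. 3, Lemma 22 and Ch. 5, Lemma 5.28] -/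
theorem gen_spec :
    IsGeodesicOn g.leviCivita F.gen
        (maximalGeodesicDomain g.leviCivita p ((F.ν 0 : E) : TangentSpace 𝓘(ℝ, E) p)) ∧
      (∀ t ∈ maximalGeodesicDomain g.leviCivita p ((F.ν 0 : E) : TangentSpace 𝓘(ℝ, E) p),
        g.val (F.gen t) (velocity 𝓘(ℝ, E) F.gen t) (velocity 𝓘(ℝ, E) F.gen t) = 0 ∧
        velocity 𝓘(ℝ, E) F.gen t ≠ 0) ∧
      (velocity 𝓘(ℝ, E) F.gen 0 : E) = F.ℓ₀ ∧ F.gen 0 = p := by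
  set v : TangentSpace 𝓘(ℝ, E) p := ((F.ν 0 : E) : TangentSpace 𝓘(ℝ, E) p) with hv
  have hvℓ : (v : E) = F.ℓ₀ := coneVector_zero F.ℓ₀ F.N₀ F.s
  set D₀ := maximalGeodesicDomain g.leviCivita p v with hD₀
  obtain ⟨hmax, h0, -, -⟩ := maximalGeodesic_spec' (cov := g.leviCivita) p v
  have hD₀o : IsOpen D₀ := hmax.isOpen
  have hD₀c : D₀.OrdConnected := hmax.2.1
  have hgeo : IsGeodesicOn g.leviCivita F.gen D₀ := isGeodesicOn_expMap_smul (cov := g.leviCivita) p v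
  have hv0 : velocity 𝓘(ℝ, E) F.gen 0 = v := velocity_expMap_smul_zero (cov := g.leviCivita) p v
  have hγ0 : F.gen 0 = p := by
    show expMap g.leviCivita p ((0 : ℝ) • v) = p
    rw [zero_smul]
    exact expMap_zero (cov := g.leviCivita) p
  have hnull0 : g.val p v v = 0 :=
    coneVector_null (E := E) (B := g.val p) (fun v w ↦ g.symm p v w)
      F.null_ℓ₀ F.null_N₀ F.cross F.screen_ℓ₀ F.screen_N₀ F.orthonormal 0
  have hvne : v ≠ 0 := by
    intro h
    apply F.ℓ₀_ne_zero
    rw [← hvℓ]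
    exact h
  refine ⟨hgeo, fun t ht ↦ ⟨?_, ?_⟩, ?_, hγ0⟩
  · have h := g.toPseudoRiemannianMetric.val_velocity_eq_of_isGeodesicOn_holds hD₀o hD₀c hgeo ht h0
    rw [hv0, hγ0] at h
    rw [h]
    exact hnull0
  · exact IsGeodesicOn.velocity_ne_zero (cov := g.leviCivita) hD₀o hD₀c hgeo h0
      (by rw [hv0]; exact hvne) ht
  · rw [hv0]; exact hvℓ

/-! ### The Gram determinant: sign, and its zeros as the conjugate points -/

/-- **The Jacobi fields depend linearly on the screen direction**: `J_w(t) = ∑ wₖ J_{eₖ}(t)`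
(all are values of the differential of the slice `E(·, t)` at `0`). [folklore] -/
theorem jacobi_eq_sum (hreg : g.leviCivita.IsLocallyContMDiff ∞)
    (hreg₁ : g.leviCivita.IsLocallyContMDiff 1) (w : Fin m → ℝ) {t : ℝ}
    (ht : t ∈ maximalGeodesicDomain g.leviCivita p ((F.ν 0 : E) : TangentSpace 𝓘(ℝ, E) p)) :
    F.jacobi w t = ∑ k, w k • F.jacobi (Pi.single k 1) t := by
  have hw : w = ∑ k, w k • (Pi.single k (1 : ℝ) : Fin m → ℝ) := by
    ext j
    simp [Finset.sum_apply, Pi.single_apply, Finset.sum_ite_eq]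
  obtain ⟨L, hL⟩ : ∃ L : (Fin m → ℝ) →L[ℝ] E, ∀ w', F.jacobi w' t = L w' :=
    ⟨mfderiv 𝓘(ℝ, Fin m → ℝ) 𝓘(ℝ, E) (fun y ↦ F.cone (y, t)) 0,
      fun w' ↦ (F.jacobi_spec hreg hreg₁ w' ht).2.2.2.2.2.2.2⟩
  rw [hL w]
  conv_lhs => rw [hw]
  rw [map_sum]
  refine Finset.sum_congr rfl fun k _ ↦ ?_
  rw [map_smul, hL (Pi.single k 1)]

/-- **`D(t) ≥ 0`**: the Gram matrix of the screen Jacobi fields (all orthogonal to the null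
velocity `σ'(t)`) is positive semidefinite. [cite: HawkingEllis1973CUP, §4.5] -/
theorem gramDet_nonneg (hreg : g.leviCivita.IsLocallyContMDiff ∞)
    (hreg₁ : g.leviCivita.IsLocallyContMDiff 1) {t : ℝ}
    (ht : t ∈ maximalGeodesicDomain g.leviCivita p ((F.ν 0 : E) : TangentSpace 𝓘(ℝ, E) p)) :
    0 ≤ F.gramDet t := by
  obtain ⟨-, hgen, -, -⟩ := F.gen_spec
  obtain ⟨hnull, hne⟩ := hgen t ht
  have hJ := fun k ↦ (F.jacobi_spec hreg hreg₁ (Pi.single k (1 : ℝ)) ht).2.2.2.1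
  exact det_gram_nonneg_of_orthogonal_null (V := E) (g.val (F.gen t))
    (fun v w ↦ g.symm (F.gen t) v w) (fun u w ↦ g.pos_of_orthogonal (F.gen t) u w) hnull hne
    (J := fun k ↦ F.jacobi (Pi.single k 1) t) hJ

/-- **The differential of the light-cone map**: `dE_{(0,t)}(w, a) = J_w(t) + a σ'(t)`.
[cite: ONeillSemiRiemannian1983, Ch. 10, Prop. 30 (proof)] -/
theorem mfderiv_cone_apply (hreg : g.leviCivita.IsLocallyContMDiff ∞)
    (hreg₁ : g.leviCivita.IsLocallyContMDiff 1) {t : ℝ}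
    (ht : t ∈ maximalGeodesicDomain g.leviCivita p ((F.ν 0 : E) : TangentSpace 𝓘(ℝ, E) p))
    (w : Fin m → ℝ) (a : ℝ) :
    (mfderiv (𝓘(ℝ, Fin m → ℝ).prod 𝓘(ℝ, ℝ)) 𝓘(ℝ, E) F.cone ((0 : Fin m → ℝ), t)
        ((w, a) : TangentSpace (𝓘(ℝ, Fin m → ℝ).prod 𝓘(ℝ, ℝ)) ((0 : Fin m → ℝ), t)) : E) =
      F.jacobi w t + a • F.genVelocity t := by
  have hL := contMDiff_coneVector_totalSpace (M := M) p F.ℓ₀ F.N₀ F.s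
  have h := mfderiv_normalExp_apply (cov := g.leviCivita) (ι := fun _ : Fin m → ℝ ↦ p)
    (ν := fun y ↦ ((F.ν y : E) : TangentSpace 𝓘(ℝ, E) p)) hL ht w a
  rw [F.cone_eq]
  refine h.trans ?_
  have hJw : (mfderiv 𝓘(ℝ, Fin m → ℝ) 𝓘(ℝ, E) (fun y ↦ F.cone (y, t)) 0 w : E) = F.jacobi w t :=
    (F.jacobi_spec hreg hreg₁ w ht).2.2.2.2.2.2.2.symm
  exact congrArg₂ (fun u v : E ↦ u + a • v) hJw (rfl : F.genVelocity t = F.genVelocity t)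

/-- **`D(t) ≠ 0` implies `dE_{(0,t)}` is injective** (no conjugate point): a kernel vector
`(w, a)` gives `∑ wₖ J_{eₖ}(t) + a σ'(t) = 0`, and pairing with the `J_{e_l}` (all `⊥ σ'`) gives
`G(t) w = 0`. [cite: HawkingEllis1973CUP, §4.5, Prop. 4.5.12 (proof)] -/
theorem injective_mfderiv_cone_of_gramDet_ne_zero (hreg : g.leviCivita.IsLocallyContMDiff ∞)
    (hreg₁ : g.leviCivita.IsLocallyContMDiff 1) {t : ℝ}
    (ht : t ∈ maximalGeodesicDomain g.leviCivita p ((F.ν 0 : E) : TangentSpace 𝓘(ℝ, E) p))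
    (hD : F.gramDet t ≠ 0) :
    Injective (mfderiv (𝓘(ℝ, Fin m → ℝ).prod 𝓘(ℝ, ℝ)) 𝓘(ℝ, E) F.cone ((0 : Fin m → ℝ), t)) := by
  obtain ⟨-, hgen, -, -⟩ := F.gen_spec
  obtain ⟨-, hne⟩ := hgen t ht
  have hJ := fun k ↦ (F.jacobi_spec hreg hreg₁ (Pi.single k (1 : ℝ)) ht).2.2.2.1
  refine (injective_iff_map_eq_zero _).2 fun q hq ↦ ?_
  obtain ⟨w, a⟩ := q
  have h := F.mfderiv_cone_apply hreg hreg₁ ht w a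
  rw [F.jacobi_eq_sum hreg hreg₁ w ht] at h
  have h0 : ∑ k, w k • F.jacobi (Pi.single k 1) t + a • F.genVelocity t = 0 := by
    rw [← h]
    exact congrArg (fun u : TangentSpace 𝓘(ℝ, E) (F.cone (0, t)) ↦ (u : E)) hq
  obtain ⟨hw, ha⟩ := eq_zero_of_sum_smul_add_smul_null_eq_zero (V := E) (g.val (F.gen t))
    (fun v w ↦ g.symm (F.gen t) v w) hne (J := fun k ↦ F.jacobi (Pi.single k 1) t) hJ hD h0
  rw [hw, ha]
  rfl

/-- **`dE_{(0,t)}` injective implies `D(t) ≠ 0`**: if `D(t) = 0`, a nontrivial combination of the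
`J_{eₖ}(t)` is a multiple of the null velocity (`exists_sum_smul_eq_smul_null_of_det_gram_eq_zero`),
producing a kernel vector of `dE`. [cite: HawkingEllis1973CUP, §4.5, Prop. 4.5.12 (proof)] -/
theorem gramDet_ne_zero_of_injective_mfderiv_cone (hreg : g.leviCivita.IsLocallyContMDiff ∞)
    (hreg₁ : g.leviCivita.IsLocallyContMDiff 1) {t : ℝ}
    (ht : t ∈ maximalGeodesicDomain g.leviCivita p ((F.ν 0 : E) : TangentSpace 𝓘(ℝ, E) p))
    (hinj : Injective (mfderiv (𝓘(ℝ, Fin m → ℝ).prod 𝓘(ℝ, ℝ)) 𝓘(ℝ, E) F.cone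
      ((0 : Fin m → ℝ), t))) :
    F.gramDet t ≠ 0 := by
  classical
  intro hD
  obtain ⟨-, hgen, -, -⟩ := F.gen_spec
  obtain ⟨hnull, hne⟩ := hgen t ht
  have hJ := fun k ↦ (F.jacobi_spec hreg hreg₁ (Pi.single k (1 : ℝ)) ht).2.2.2.1
  obtain ⟨T', hT'⟩ := g.exists_timelike (F.gen t)
  obtain ⟨a, ha0, c', hac⟩ := exists_sum_smul_eq_smul_null_of_det_gram_eq_zero (V := E)
    (g.val (F.gen t)) (fun v w ↦ g.symm (F.gen t) v w)
    (fun u w ↦ g.pos_of_orthogonal (F.gen t) u w) hT' hnull hne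
    (J := fun k ↦ F.jacobi (Pi.single k 1) t) hJ hD
  have hker : mfderiv (𝓘(ℝ, Fin m → ℝ).prod 𝓘(ℝ, ℝ)) 𝓘(ℝ, E) F.cone ((0 : Fin m → ℝ), t)
      ((a, -c') : TangentSpace (𝓘(ℝ, Fin m → ℝ).prod 𝓘(ℝ, ℝ)) ((0 : Fin m → ℝ), t)) = 0 := by
    have h := F.mfderiv_cone_apply hreg hreg₁ ht a (-c')
    rw [F.jacobi_eq_sum hreg hreg₁ a ht] at h
    have hac' : ∑ k, a k • F.jacobi (Pi.single k 1) t = c' • F.genVelocity t := hac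
    rw [hac', neg_smul, ← sub_eq_add_neg, sub_self] at h
    exact h
  have hzero : ((a, -c') : TangentSpace (𝓘(ℝ, Fin m → ℝ).prod 𝓘(ℝ, ℝ)) ((0 : Fin m → ℝ), t)) = 0 :=
    hinj (hker.trans (map_zero _).symm)
  exact ha0 (congrArg Prod.fst hzero)

/-! ### No conjugate points near the vertex -/

omit [Fact (1 ≤ n)] in
/-- **There are no conjugate points near the vertex**: for `t ≠ 0` small (in the domain),
`dE_{(0,t)}` is injective — `E = exp_p ∘ S`, `S(y, t) = t ν(y)`, where `exp_p` is a local
diffeomorphism near `0 ∈ T_pM` (`isLocalDiffeomorphAt_expMap_zero_of_le`, Lee 2018,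
Prop. 5.19 (d)) and `dS_{(0,t)}(w, a) = t dν₀(w) + a ℓ₀ = t ∑ wᵢ sᵢ + a ℓ₀` is injective for
`t ≠ 0` (screen and generator independent). Hawking–Ellis 1973, §4.5 (normal neighbourhoods
contain no conjugate points); O'Neill 1983, Ch. 10, Cor. 12.
[cite: HawkingEllis1973CUP, §4.5] [cite: ONeillSemiRiemannian1983, Ch. 10, Cor. 12] -/
theorem exists_injective_mfderiv_cone_near_vertex :
    ∃ ε > 0, ∀ t : ℝ, t ≠ 0 → |t| < ε →
      Injective (mfderiv (𝓘(ℝ, Fin m → ℝ).prod 𝓘(ℝ, ℝ)) 𝓘(ℝ, E) F.cone ((0 : Fin m → ℝ), t)) := by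
  -- `exp_p` is a local diffeomorphism near `0`
  obtain ⟨Φ, h0Φ, heqΦ⟩ := isLocalDiffeomorphAt_expMap_zero_of_le (cov := g.leviCivita)
    (I := 𝓘(ℝ, E)) (k := (⊤ : ℕ∞)) le_top p
  set f : E → M := fun v : E ↦ expMap g.leviCivita p (show TangentSpace 𝓘(ℝ, E) p from v) with hf
  have hinjf : ∀ v ∈ Φ.source, Injective (mfderiv 𝓘(ℝ, E) 𝓘(ℝ, E) f v) := fun v hv ↦ by
    have hloc : IsLocalDiffeomorphAt 𝓘(ℝ, E) 𝓘(ℝ, E) (⊤ : ℕ∞) f v := ⟨Φ, hv, heqΦ⟩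
    exact (hloc.mfderivToContinuousLinearEquiv (by simp)).injective
  have hdf : ∀ v ∈ Φ.source, MDifferentiableAt 𝓘(ℝ, E) 𝓘(ℝ, E) f v := fun v hv ↦
    ((Φ.mdifferentiableAt (by simp) hv).congr_of_eventuallyEq
      ((heqΦ.eventuallyEq_of_mem (Φ.open_source.mem_nhds hv))))
  -- `t ν(0) ∈ Φ.source` for small `t`
  have hsrc : ∀ᶠ t : ℝ in 𝓝 0, t • F.ν 0 ∈ Φ.source := by
    have hc : Tendsto (fun t : ℝ ↦ t • F.ν 0) (𝓝 0) (𝓝 0) := by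
      have h : Continuous (fun t : ℝ ↦ t • F.ν 0) := continuous_id.smul continuous_const
      simpa using h.tendsto 0
    exact hc (Φ.open_source.mem_nhds h0Φ)
  obtain ⟨ε, hε, hεs⟩ := Metric.eventually_nhds_iff.1 hsrc
  refine ⟨ε, hε, fun t ht htε ↦ ?_⟩
  have hts : t • F.ν 0 ∈ Φ.source := hεs (by simpa [Real.dist_eq] using htε)
  -- `E = f ∘ S`
  set S : (Fin m → ℝ) × ℝ → E := fun q ↦ q.2 • F.ν q.1 with hS
  have hconeS : F.cone = f ∘ S := rfl
  have hSsm : ContMDiff (𝓘(ℝ, Fin m → ℝ).prod 𝓘(ℝ, ℝ)) 𝓘(ℝ, E) ∞ S := by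
    have h : ContDiff ℝ ∞ (fun q : (Fin m → ℝ) × ℝ ↦ q.2 • F.ν q.1) :=
      contDiff_snd.smul ((contDiff_coneVector F.ℓ₀ F.N₀ F.s).comp contDiff_fst)
    have h' := h.contMDiff
    rw [modelWithCornersSelf_prod, ← chartedSpaceSelf_prod] at h'
    exact h'
  have hSd : MDifferentiableAt (𝓘(ℝ, Fin m → ℝ).prod 𝓘(ℝ, ℝ)) 𝓘(ℝ, E) S ((0 : Fin m → ℝ), t) :=
    (hSsm _).mdifferentiableAt (by simp)
  have hS0 : S ((0 : Fin m → ℝ), t) = t • F.ν 0 := rfl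
  rw [hconeS, mfderiv_comp _ (by rw [hS0]; exact hdf _ hts) hSd]
  refine (hinjf _ (by rw [hS0]; exact hts)).comp ?_
  -- `dS_{(0,t)}(w, a) = t dν₀(w) + a ν(0)` is injective for `t ≠ 0`
  have hpart : ∀ (w : Fin m → ℝ) (a : ℝ),
      (mfderiv (𝓘(ℝ, Fin m → ℝ).prod 𝓘(ℝ, ℝ)) 𝓘(ℝ, E) S ((0 : Fin m → ℝ), t)
        ((w, a) : TangentSpace (𝓘(ℝ, Fin m → ℝ).prod 𝓘(ℝ, ℝ)) ((0 : Fin m → ℝ), t)) : E) =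
        t • ∑ i, w i • F.s i + a • F.ν 0 := by
    intro w a
    rw [mfderiv_prod_eq_add_apply hSd]
    have h1 : (mfderiv 𝓘(ℝ, Fin m → ℝ) 𝓘(ℝ, E) (fun y : Fin m → ℝ ↦ S (y, t)) 0 w : E) =
        t • ∑ i, w i • F.s i := by
      have hd : HasFDerivAt (fun y : Fin m → ℝ ↦ t • F.ν y)
          (t • ∑ i, (ContinuousLinearMap.proj (R := ℝ) (φ := fun _ : Fin m ↦ ℝ) i).smulRight (F.s i))
          0 := (hasFDerivAt_coneVector_zero F.ℓ₀ F.N₀ F.s).const_smul t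
      have h := (hasMFDerivAt_iff_hasFDerivAt.2 hd).mfderiv
      have h' := congrArg (fun L : (Fin m → ℝ) →L[ℝ] E ↦ (L w : E)) h
      refine h'.trans ?_
      simp
    have h2 : (mfderiv 𝓘(ℝ, ℝ) 𝓘(ℝ, E) (fun a' : ℝ ↦ S (0, a')) t a : E) = a • F.ν 0 := by
      have hd : HasFDerivAt (fun a' : ℝ ↦ a' • F.ν 0)
          ((ContinuousLinearMap.id ℝ ℝ).smulRight (F.ν 0)) t := (hasFDerivAt_id t).smul_const _
      have h := (hasMFDerivAt_iff_hasFDerivAt.2 hd).mfderiv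
      have h' := congrArg (fun L : ℝ →L[ℝ] E ↦ (L a : E)) h
      refine h'.trans ?_
      simp
    exact congrArg₂ (fun u v : E ↦ u + v) h1 h2
  -- the scalar product at `p`, read on the model space
  obtain ⟨Bp, hBp⟩ : ∃ B : E →L[ℝ] E →L[ℝ] ℝ, ∀ u v : E, B u v = g.val p u v :=
    ⟨g.val p, fun _ _ ↦ rfl⟩
  have hBsymm : ∀ u v : E, Bp u v = Bp v u := fun u v ↦ by rw [hBp, hBp]; exact g.symm p u v
  have hsℓ : ∀ k, Bp (F.s k) F.ℓ₀ = 0 := fun k ↦ (hBp _ _).trans (F.screen_ℓ₀ k)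
  have hss : ∀ k l, Bp (F.s k) (F.s l) = if k = l then 1 else 0 := fun k l ↦
    (hBp _ _).trans (F.orthonormal k l)
  refine (injective_iff_map_eq_zero _).2 fun q hq ↦ ?_
  obtain ⟨w, a⟩ := q
  have h0 : ∑ i, w i • (t • F.s i) + a • F.ℓ₀ = 0 := by
    have h : t • ∑ i, w i • F.s i + a • F.ν 0 = 0 :=
      (hpart w a).symm.trans (congrArg (fun u : TangentSpace 𝓘(ℝ, E) (S ((0 : Fin m → ℝ), t)) ↦
        (u : E)) hq)
    simp only [NullConeFrame.ν, coneVector_zero] at h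
    have h' : ∑ i, w i • (t • F.s i) = t • ∑ i, w i • F.s i := by
      rw [Finset.smul_sum]
      exact Finset.sum_congr rfl fun i _ ↦ smul_comm _ _ _
    rw [h']
    exact h
  -- the Gram matrix of `t sᵢ` is `t² · 1`, with nonzero determinant
  have hJ : ∀ k, Bp (t • F.s k) F.ℓ₀ = 0 := fun k ↦ by
    rw [map_smul, _root_.smul_apply, hsℓ k, smul_zero]
  have hdet : (Matrix.of fun k l ↦ Bp (t • F.s k) (t • F.s l)).det ≠ 0 := by
    have hG : (Matrix.of fun k l ↦ Bp (t • F.s k) (t • F.s l)) =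
        Matrix.diagonal fun _ ↦ t ^ 2 := by
      ext k l
      simp only [Matrix.of_apply, map_smul, _root_.smul_apply, smul_eq_mul, hss,
        Matrix.diagonal_apply]
      split_ifs <;> ring
    rw [hG, Matrix.det_diagonal, Finset.prod_const]
    exact pow_ne_zero _ (pow_ne_zero 2 ht)
  obtain ⟨hw, ha⟩ := eq_zero_of_sum_smul_add_smul_null_eq_zero (V := E) Bp hBsymm
    F.ℓ₀_ne_zero (J := fun k ↦ t • F.s k) hJ hdet h0
  rw [hw, ha]
  rfl

/-! ### The expansion `θ = D'/(2D)` as a sum over an orthonormal screen frame -/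

/-- **The expansion of the light cone.** `θ(t) = D'(t)/(2 D(t))`, the logarithmic derivative of
the area element of the null cone along the central generator (Hawking–Ellis 1973, (4.35):
`θ` is the rate of change of the area of the cross-sections of the congruence).
[cite: HawkingEllis1973CUP, §4.4, (4.35)] -/
def expansion (t : ℝ) : ℝ := deriv F.gramDet t / (2 * F.gramDet t)

/-- **`θ(u) = ∑ₐ g(D_t J_{bₐ}(u), J_{bₐ}(u))` for an orthonormal Jacobi frame.** At a parameter
`u` of the generator where `D(u) ≠ 0` (no conjugate point) there is a basis `b` of the screen
coordinates whose Jacobi fields are `g`-orthonormal at `u`, and for any such basis the expansion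
`D'/(2D)(u)` is the sum of `g(D_t J_{bₐ}, J_{bₐ})(u)`: the Gram determinant of the frame `b` is
`(det P)² D` (`P` the change of basis), so the logarithmic derivatives agree, and the frame-free
Jacobi formula `D'/(2D) = tr(G⁻¹Ω)` (`deriv_det_gram_div_eq_trace`) has `G(u) = 1`.
Hawking–Ellis 1973, (4.26)/(4.35) (`θ = χ^a{}_a` in a pseudo-orthonormal frame).
[cite: HawkingEllis1973CUP, §4.2, (4.26) and §4.4, (4.35)] -/
theorem exists_basis_expansion_eq_sum (hreg : g.leviCivita.IsLocallyContMDiff ∞)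
    (hreg₁ : g.leviCivita.IsLocallyContMDiff 1) {u : ℝ}
    (hu : u ∈ maximalGeodesicDomain g.leviCivita p ((F.ν 0 : E) : TangentSpace 𝓘(ℝ, E) p))
    (hD : F.gramDet u ≠ 0) :
    ∃ b : Module.Basis (Fin m) ℝ (Fin m → ℝ),
      (∀ i j, g.val (F.gen u) (F.jacobi (b i) u) (F.jacobi (b j) u) = if i = j then 1 else 0) ∧
      F.expansion u = ∑ i, g.val (F.gen u)
        (covariantDerivAlong g.leviCivita F.gen (F.jacobi (b i)) u) (F.jacobi (b i) u) := by
  classical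
  have hLC := PseudoRiemannianMetric.isLeviCivita_leviCivita_holds (g := g.toPseudoRiemannianMetric)
  have hcompat : g.IsCompatible g.leviCivita := hLC.2
  obtain ⟨-, hgen, -, -⟩ := F.gen_spec
  obtain ⟨hnull, hne⟩ := hgen u hu
  -- the scalar product at `σ u` on the model space, and the linear map `w ↦ J_w(u)`
  obtain ⟨Bu, hBu⟩ : ∃ B : E →L[ℝ] E →L[ℝ] ℝ, ∀ x y : E, B x y = g.val (F.gen u) x y :=
    ⟨g.val (F.gen u), fun _ _ ↦ rfl⟩
  have hBsymm : ∀ x y : E, Bu x y = Bu y x := fun x y ↦ by rw [hBu, hBu]; exact g.symm _ x y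
  have hBpos : ∀ x y : E, Bu x x < 0 → Bu x y = 0 → y ≠ 0 → 0 < Bu y y := fun x y h1 h2 h3 ↦ by
    rw [hBu] at h1 h2 ⊢; exact g.pos_of_orthogonal (F.gen u) x y h1 h2 h3
  obtain ⟨L, hL⟩ : ∃ L : (Fin m → ℝ) →L[ℝ] E, ∀ w, F.jacobi w u = L w :=
    ⟨mfderiv 𝓘(ℝ, Fin m → ℝ) 𝓘(ℝ, E) (fun y ↦ F.cone (y, u)) 0,
      fun w ↦ (F.jacobi_spec hreg hreg₁ w hu).2.2.2.2.2.2.2⟩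
  have hLperp : ∀ w, Bu (L w) (F.genVelocity u) = 0 := fun w ↦ by
    rw [hBu, ← hL]; exact (F.jacobi_spec hreg hreg₁ w hu).2.2.2.1
  have hℓnull : Bu (F.genVelocity u) (F.genVelocity u) = 0 := by rw [hBu]; exact hnull
  have hℓne : F.genVelocity u ≠ 0 := hne
  -- the induced form on the screen coordinates is symmetric positive definite
  set B : LinearMap.BilinForm ℝ (Fin m → ℝ) := LinearMap.mk₂ ℝ (fun w w' ↦ Bu (L w) (L w'))
    (fun w₁ w₂ w' ↦ by simp only [map_add, _root_.add_apply])
    (fun c w w' ↦ by simp only [map_smul, _root_.smul_apply, smul_eq_mul])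
    (fun w w₁ w₂ ↦ by simp only [map_add])
    (fun c w w' ↦ by simp only [map_smul, smul_eq_mul]) with hBdef
  have hBapply : ∀ w w', B w w' = Bu (L w) (L w') := fun w w' ↦ rfl
  have hBs : ∀ w w', B w w' = B w' w := fun w w' ↦ by rw [hBapply, hBapply, hBsymm]
  have hBp : ∀ w, w ≠ 0 → 0 < B w w := by
    intro w hw
    rw [hBapply]
    have hnn := nonneg_of_orthogonal_null (B := Bu) hBpos hℓnull hℓne (hLperp w)
    rcases hnn.lt_or_eq with hlt | heq
    · exact hlt
    · exfalso
      obtain ⟨T', hT'⟩ := g.exists_timelike (F.gen u)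
      have hT'' : Bu T' T' < 0 := by rw [hBu]; exact hT'
      obtain ⟨c, hc⟩ := exists_smul_of_orthogonal_null (B := Bu) hBsymm hBpos hT'' hℓnull hℓne
        (hLperp w) heq.symm
      have hinj := F.injective_mfderiv_cone_of_gramDet_ne_zero hreg hreg₁ hu hD
      have hker : mfderiv (𝓘(ℝ, Fin m → ℝ).prod 𝓘(ℝ, ℝ)) 𝓘(ℝ, E) F.cone ((0 : Fin m → ℝ), u)
          ((w, -c) : TangentSpace (𝓘(ℝ, Fin m → ℝ).prod 𝓘(ℝ, ℝ)) ((0 : Fin m → ℝ), u)) = 0 := by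
        have h := F.mfderiv_cone_apply hreg hreg₁ hu w (-c)
        rw [hL w, hc, neg_smul, add_neg_cancel] at h
        exact h
      have hzero : ((w, -c) : TangentSpace (𝓘(ℝ, Fin m → ℝ).prod 𝓘(ℝ, ℝ)) ((0 : Fin m → ℝ), u)) = 0 :=
        hinj (hker.trans (map_zero _).symm)
      exact hw (congrArg Prod.fst hzero)
  -- an orthonormal basis for it, reindexed by `Fin m`
  obtain ⟨b₀, hb₀⟩ := exists_basis_orthonormal_of_posDef B hBs hBp
  set b : Module.Basis (Fin m) ℝ (Fin m → ℝ) :=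
    b₀.reindex (finCongr (Module.finrank_fin_fun ℝ)) with hb
  have hbon : ∀ i j, Bu (L (b i)) (L (b j)) = if i = j then 1 else 0 := by
    intro i j
    have h := hb₀ ((finCongr (Module.finrank_fin_fun ℝ)).symm i)
      ((finCongr (Module.finrank_fin_fun ℝ)).symm j)
    simp only [hb, Module.Basis.reindex_apply, hBapply,
      EmbeddingLike.apply_eq_iff_eq] at h ⊢
    exact h
  refine ⟨b, fun i j ↦ ?_, ?_⟩
  · rw [hL, hL, ← hBu]; exact hbon i j
  -- the Gram determinant of the frame `b` is `(det P)² D`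
  set P : Matrix (Fin m) (Fin m) ℝ := Matrix.of fun k a ↦ b a k with hP
  set Db : ℝ → ℝ := fun t ↦ (Matrix.of fun i j ↦
    g.val (F.gen t) (F.jacobi (b i) t) (F.jacobi (b j) t)).det with hDb
  have hdom : ∀ᶠ t in 𝓝 u, t ∈ maximalGeodesicDomain g.leviCivita p
      ((F.ν 0 : E) : TangentSpace 𝓘(ℝ, E) p) :=
    (maximalGeodesic_spec' (cov := g.leviCivita) p _).1.isOpen.mem_nhds hu
  have hPb : P = (Pi.basisFun ℝ (Fin m)).toMatrix b := by
    ext k a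
    rw [hP, Matrix.of_apply, Module.Basis.toMatrix_apply, Pi.basisFun_repr]
  have hGram : ∀ t ∈ maximalGeodesicDomain g.leviCivita p ((F.ν 0 : E) : TangentSpace 𝓘(ℝ, E) p),
      (Matrix.of fun i j ↦ g.val (F.gen t) (F.jacobi (b i) t) (F.jacobi (b j) t)) =
        Pᵀ * F.gram t * P := by
    intro t ht
    obtain ⟨Bt, hBt⟩ : ∃ B : E →L[ℝ] E →L[ℝ] ℝ, ∀ x y : E, B x y = g.val (F.gen t) x y :=
      ⟨g.val (F.gen t), fun _ _ ↦ rfl⟩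
    obtain ⟨Lt, hLt⟩ : ∃ L : (Fin m → ℝ) →L[ℝ] E, ∀ w, F.jacobi w t = L w :=
      ⟨mfderiv 𝓘(ℝ, Fin m → ℝ) 𝓘(ℝ, E) (fun y ↦ F.cone (y, t)) 0,
        fun w ↦ (F.jacobi_spec hreg hreg₁ w ht).2.2.2.2.2.2.2⟩
    -- the bilinear form `w, w' ↦ g(J_w(t), J_{w'}(t))` on the screen coordinates
    set Bf : LinearMap.BilinForm ℝ (Fin m → ℝ) := LinearMap.mk₂ ℝ (fun w w' ↦ Bt (Lt w) (Lt w'))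
      (fun w₁ w₂ w' ↦ by simp only [map_add, _root_.add_apply])
      (fun c w w' ↦ by simp only [map_smul, _root_.smul_apply, smul_eq_mul])
      (fun w w₁ w₂ ↦ by simp only [map_add])
      (fun c w w' ↦ by simp only [map_smul, smul_eq_mul]) with hBfdef
    have hBf : ∀ w w', Bf w w' = g.val (F.gen t) (F.jacobi w t) (F.jacobi w' t) := fun w w' ↦ by
      rw [hLt, hLt, ← hBt]; rfl
    have hstd : LinearMap.BilinForm.toMatrix (Pi.basisFun ℝ (Fin m)) Bf = F.gram t := by
      ext k l
      rw [LinearMap.BilinForm.toMatrix_apply, hBf, Pi.basisFun_apply, Pi.basisFun_apply]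
      rfl
    have hbb : LinearMap.BilinForm.toMatrix b Bf =
        Matrix.of fun i j ↦ g.val (F.gen t) (F.jacobi (b i) t) (F.jacobi (b j) t) := by
      ext i j
      rw [LinearMap.BilinForm.toMatrix_apply, hBf, Matrix.of_apply]
    rw [← hbb, ← hstd, hPb]
    exact (LinearMap.BilinForm.toMatrix_mul_basis_toMatrix (Pi.basisFun ℝ (Fin m)) b Bf).symm
  have hDbD : ∀ᶠ t in 𝓝 u, Db t = P.det ^ 2 * F.gramDet t := by
    filter_upwards [hdom] with t ht
    simp only [hDb, hGram t ht, Matrix.det_mul, Matrix.det_transpose, NullConeFrame.gramDet]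
    ring
  have hPdet : P.det ≠ 0 := by
    rw [hPb, ← Module.Basis.det_apply]
    exact ((Pi.basisFun ℝ (Fin m)).isUnit_det b).ne_zero
  -- logarithmic derivatives agree
  have hDbu : Db u = P.det ^ 2 * F.gramDet u := hDbD.self_of_nhds
  have hDbne : Db u ≠ 0 := by
    rw [hDbu]; exact mul_ne_zero (pow_ne_zero 2 hPdet) hD
  have hDbD' : Db =ᶠ[𝓝 u] fun t ↦ P.det ^ 2 * F.gramDet t := hDbD
  have hlog : deriv Db u / (2 * Db u) = F.expansion u := by
    rw [hDbD'.deriv_eq, hDbu]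
    simp only [NullConeFrame.expansion]
    rw [deriv_const_mul_field]
    have h2 : P.det ^ 2 ≠ 0 := pow_ne_zero 2 hPdet
    field_simp
  -- the frame-free Jacobi formula for the frame `b`, with `G_b(u) = 1`
  have hJd : ∀ i, MDifferentiableAt 𝓘(ℝ, ℝ) 𝓘(ℝ, E).tangent (fun t ↦ (TotalSpace.mk' E (F.gen t)
      (F.jacobi (b i) t) : TangentBundle 𝓘(ℝ, E) M)) u :=
    fun i ↦ (F.jacobi_spec hreg hreg₁ (b i) hu).2.1
  have hdet : (Matrix.of fun i j ↦ g.val (F.gen u) (F.jacobi (b i) u) (F.jacobi (b j) u)).det ≠ 0 :=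
    hDbne
  have hformula := deriv_det_gram_div_eq_trace g.toPseudoRiemannianMetric hcompat
    (γ := F.gen) (J := fun i t ↦ (F.jacobi (b i) t : TangentSpace 𝓘(ℝ, E) (F.gen t))) hJd hdet
  have hGu : (Matrix.of fun i j ↦ g.val (F.gen u) (F.jacobi (b i) u) (F.jacobi (b j) u)) = 1 := by
    ext i j
    rw [Matrix.of_apply, ← hBu, hL, hL, hbon i j, Matrix.one_apply]
  rw [← hlog]
  show deriv Db u / (2 * Db u) = _
  refine hformula.trans ?_
  rw [hGu, inv_one, Matrix.one_mul, Matrix.trace]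
  simp only [Matrix.diag_apply, Matrix.of_apply]

/-! ### Regularity of `D` and `θ` along the generator -/

/-- The derivative of the Gram matrix: `G' = Ω + Ωᵀ`, `Ω_{kl} = g(D_t J_k, J_l)`. [folklore] -/
def gramDeriv (t : ℝ) : Matrix (Fin m) (Fin m) ℝ :=
  Matrix.of fun k l ↦
    g.val (F.gen t) (covariantDerivAlong g.leviCivita F.gen (F.jacobi (Pi.single k 1)) t)
        (F.jacobi (Pi.single l 1) t) +
      g.val (F.gen t) (F.jacobi (Pi.single k 1) t)
        (covariantDerivAlong g.leviCivita F.gen (F.jacobi (Pi.single l 1)) t)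

/-- **The Gram matrix is differentiable along the generator**, entrywise with derivative
`gramDeriv` (metric compatibility, `hasDerivAt_val_apply_along`). [cite: ONeillSemiRiemannian1983, Ch. 3, Prop. 18 (3)] -/
theorem hasDerivAt_gram (hreg : g.leviCivita.IsLocallyContMDiff ∞)
    (hreg₁ : g.leviCivita.IsLocallyContMDiff 1) {t : ℝ}
    (ht : t ∈ maximalGeodesicDomain g.leviCivita p ((F.ν 0 : E) : TangentSpace 𝓘(ℝ, E) p)) :
    HasDerivAt (fun s ↦ (F.gram s : Fin m → Fin m → ℝ)) (F.gramDeriv t : Fin m → Fin m → ℝ) t := by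
  have hLC := PseudoRiemannianMetric.isLeviCivita_leviCivita_holds (g := g.toPseudoRiemannianMetric)
  refine hasDerivAt_pi.2 fun k ↦ hasDerivAt_pi.2 fun l ↦ ?_
  exact g.hasDerivAt_val_apply_along hLC.2 (F.jacobi_spec hreg hreg₁ (Pi.single k 1) ht).2.1
    (F.jacobi_spec hreg hreg₁ (Pi.single l 1) ht).2.1

/-- **`D` is differentiable along the generator** (Jacobi's formula, row form).
[cite: HawkingEllis1973CUP, §4.4] -/
theorem hasDerivAt_gramDet (hreg : g.leviCivita.IsLocallyContMDiff ∞)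
    (hreg₁ : g.leviCivita.IsLocallyContMDiff 1) {t : ℝ}
    (ht : t ∈ maximalGeodesicDomain g.leviCivita p ((F.ν 0 : E) : TangentSpace 𝓘(ℝ, E) p)) :
    HasDerivAt F.gramDet (∑ j, ((F.gram t).updateRow j (F.gramDeriv t j)).det) t := by
  have h := Literature.Analysis.Calculus.hasDerivAt_det_rows
    (m := fun s ↦ (F.gram s : Fin m → Fin m → ℝ)) (F.hasDerivAt_gram hreg hreg₁ ht)
  exact h

/-- The entries of `gramDeriv` are continuous along the generator (they are differentiable:
the lifts of `J` and `D_t J` are differentiable). [folklore] -/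
theorem continuousAt_gramDeriv (hreg : g.leviCivita.IsLocallyContMDiff ∞)
    (hreg₁ : g.leviCivita.IsLocallyContMDiff 1) {t : ℝ}
    (ht : t ∈ maximalGeodesicDomain g.leviCivita p ((F.ν 0 : E) : TangentSpace 𝓘(ℝ, E) p)) :
    ContinuousAt (fun s ↦ (F.gramDeriv s : Fin m → Fin m → ℝ)) t := by
  have hLC := PseudoRiemannianMetric.isLeviCivita_leviCivita_holds (g := g.toPseudoRiemannianMetric)
  refine continuousAt_pi.2 fun k ↦ continuousAt_pi.2 fun l ↦ ?_
  have hk := F.jacobi_spec hreg hreg₁ (Pi.single k 1) ht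
  have hl := F.jacobi_spec hreg hreg₁ (Pi.single l 1) ht
  exact ((g.hasDerivAt_val_apply_along hLC.2 hk.2.2.1 hl.2.1).continuousAt).add
    ((g.hasDerivAt_val_apply_along hLC.2 hk.2.1 hl.2.2.1).continuousAt)

/-- **The expansion `θ = D'/(2D)` is continuous at every non-conjugate parameter.**
[cite: HawkingEllis1973CUP, §4.4, (4.35)] -/
theorem continuousAt_expansion (hreg : g.leviCivita.IsLocallyContMDiff ∞)
    (hreg₁ : g.leviCivita.IsLocallyContMDiff 1) {t : ℝ}
    (ht : t ∈ maximalGeodesicDomain g.leviCivita p ((F.ν 0 : E) : TangentSpace 𝓘(ℝ, E) p))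
    (hD : F.gramDet t ≠ 0) : ContinuousAt F.expansion t := by
  have hdom : ∀ᶠ s in 𝓝 t, s ∈ maximalGeodesicDomain g.leviCivita p
      ((F.ν 0 : E) : TangentSpace 𝓘(ℝ, E) p) :=
    (maximalGeodesic_spec' (cov := g.leviCivita) p _).1.isOpen.mem_nhds ht
  -- `D'` agrees near `t` with the continuous Jacobi expression
  have hderiv : deriv F.gramDet =ᶠ[𝓝 t]
      fun s ↦ ∑ j, ((F.gram s).updateRow j (F.gramDeriv s j)).det := by
    filter_upwards [hdom] with s hs
    exact (F.hasDerivAt_gramDet hreg hreg₁ hs).deriv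
  have hGc : ContinuousAt (fun s ↦ (F.gram s : Fin m → Fin m → ℝ)) t :=
    continuousAt_pi.2 fun k ↦ continuousAt_pi.2 fun l ↦
      ((hasDerivAt_pi.1 ((hasDerivAt_pi.1 (F.hasDerivAt_gram hreg hreg₁ ht)) k)) l).continuousAt
  have hG'c := F.continuousAt_gramDeriv hreg hreg₁ ht
  have hsum : ContinuousAt (fun s ↦ ∑ j, ((F.gram s).updateRow j (F.gramDeriv s j)).det) t := by
    refine tendsto_finsetSum _ fun j _ ↦ ?_
    have hrow : ContinuousAt (fun s ↦ ((F.gram s).updateRow j (F.gramDeriv s j))) t := by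
      refine continuousAt_pi.2 fun k ↦ continuousAt_pi.2 fun l ↦ ?_
      by_cases hkj : k = j
      · subst hkj
        simp only [Matrix.updateRow_self]
        exact (continuousAt_pi.1 ((continuousAt_pi.1 hG'c) k) l)
      · simp only [Matrix.updateRow_ne hkj]
        exact (continuousAt_pi.1 ((continuousAt_pi.1 hGc) k) l)
    exact (continuous_id.matrix_det.continuousAt).comp hrow
  have hD'c : ContinuousAt (deriv F.gramDet) t := hsum.congr hderiv.symm
  have hDc : ContinuousAt F.gramDet t := (F.hasDerivAt_gramDet hreg hreg₁ ht).continuousAt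
  unfold NullConeFrame.expansion
  exact hD'c.div (continuousAt_const.mul hDc) (mul_ne_zero two_ne_zero hD)

/-! ### The generator field of the light cone and its second fundamental form on the screen -/

/-- **The generator (null tangent) field of the light cone**: `K(y, t) = ∂_t E(y, t)`, read in
the model space. [cite: HawkingEllis1973CUP, §4.5] -/
def coneVelocity (q : (Fin m → ℝ) × ℝ) : E := velocity 𝓘(ℝ, E) (fun t' : ℝ ↦ F.cone (q.1, t')) q.2

/-- **The null second fundamental form of the light cone on screen directions is `g(D_t J_w, J_w)`.**
At the point `E(0, u)` of the central generator, the covariant derivative of the generator field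
`K` in the screen direction `(w, 0)` (along the hypersurface parametrisation `E`) is the covariant
derivative along the generator of the Jacobi field `J_w` (symmetry lemma
`normalDerivAlong_slice_eq`, transported from the slice `E(·, u)` to `E`).
[cite: HawkingEllis1973CUP, §4.2, (4.19)–(4.26)] -/
theorem normalDerivAlong_cone_eq (hreg₁ : g.leviCivita.IsLocallyContMDiff 1) {u : ℝ}
    (hu : u ∈ maximalGeodesicDomain g.leviCivita p ((F.ν 0 : E) : TangentSpace 𝓘(ℝ, E) p))
    (w : Fin m → ℝ) :
    (g.normalDerivAlong (I' := 𝓘(ℝ, (Fin m → ℝ) × ℝ)) F.cone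
        (fun q ↦ (F.coneVelocity q : TangentSpace 𝓘(ℝ, E) (F.cone q)))
        ((0 : Fin m → ℝ), u) ((w, 0) : (Fin m → ℝ) × ℝ) : E) =
      covariantDerivAlong g.leviCivita F.gen (F.jacobi w) u := by
  have hL := contMDiff_coneVector_totalSpace (M := M) p F.ℓ₀ F.N₀ F.s
  have h := normalDerivAlong_slice_eq g (I' := 𝓘(ℝ, Fin m → ℝ)) (f := fun _ : Fin m → ℝ ↦ p)
    (L := fun y ↦ ((F.ν y : E) : TangentSpace 𝓘(ℝ, E) p)) hreg₁ hL 0 w hu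
  refine Eq.trans ?_ h
  -- both normal derivatives are covariant derivatives along the same lifted curve
  refine covariantDerivAlong_congr_of_eventuallyEq g.leviCivita (Eventually.of_forall fun s ↦ ?_)
  have hpt : curveThrough 𝓘(ℝ, (Fin m → ℝ) × ℝ) ((0 : Fin m → ℝ), u) ((w, 0) : (Fin m → ℝ) × ℝ) s =
      (curveThrough 𝓘(ℝ, Fin m → ℝ) (0 : Fin m → ℝ) w s, u) := by
    simp [curveThrough]
  have hfun : ∀ q : (Fin m → ℝ) × ℝ, (TotalSpace.mk' E (F.cone q) (F.coneVelocity q) :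
      TangentBundle 𝓘(ℝ, E) M) = TotalSpace.mk' E
        (expMap g.leviCivita p (q.2 • ((F.ν q.1 : E) : TangentSpace 𝓘(ℝ, E) p)))
        (velocity 𝓘(ℝ, E) (fun s' : ℝ ↦ expMap g.leviCivita p
          (s' • ((F.ν q.1 : E) : TangentSpace 𝓘(ℝ, E) p))) q.2) := fun q ↦ rfl
  exact (congrArg (fun q : (Fin m → ℝ) × ℝ ↦ (TotalSpace.mk' E (F.cone q) (F.coneVelocity q) :
      TangentBundle 𝓘(ℝ, E) M)) hpt).trans (hfun _)

/-! ### Existence of null frames -/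

omit [CompleteSpace E] [T2Space M] [CovariantDerivative.ContMDiffCovariantDerivative g.leviCivita 1]
  [CovariantDerivative.ContMDiffCovariantDerivative g.leviCivita (⊤ : ℕ∞)] [g.HasLeviCivita]
  [Fact (1 ≤ n)] in
/-- **Every nonzero null vector at a point extends to a null frame** with `dim M - 2` screen
vectors: given a timelike `T`, take `N₀` the second null direction of `span{T, ℓ}` normalised by
`g(ℓ, N₀) = -1`, and an orthonormal screen `⊥ ℓ, T` (`exists_orthonormal_screen`).
Hawking–Ellis 1973, §4.2; O'Neill 1983, Ch. 5, Lemma 26 ff. [cite: HawkingEllis1973CUP, §4.2] -/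
theorem _root_.Literature.Geometry.Lorentzian.exists_nullConeFrame (p : M) {T ℓ : E}
    (hT : g.val p T T < 0) (hℓ0 : g.val p ℓ ℓ = 0) (hℓ : ℓ ≠ 0) :
    ∃ F : NullConeFrame g p (Module.finrank ℝ E - 2), F.ℓ₀ = ℓ := by
  obtain ⟨B, hB⟩ : ∃ B : E →L[ℝ] E →L[ℝ] ℝ, ∀ u v : E, B u v = g.val p u v :=
    ⟨g.val p, fun _ _ ↦ rfl⟩
  have hBs : ∀ u v : E, B u v = B v u := fun u v ↦ by rw [hB, hB]; exact g.symm p u v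
  have hBpos : ∀ x y : E, B x x < 0 → B x y = 0 → y ≠ 0 → 0 < B y y := fun x y h1 h2 h3 ↦ by
    rw [hB] at h1 h2 ⊢; exact g.pos_of_orthogonal p x y h1 h2 h3
  have hT' : B T T < 0 := by rw [hB]; exact hT
  have hℓ0' : B ℓ ℓ = 0 := by rw [hB]; exact hℓ0
  obtain ⟨e, heon, heℓ, heT⟩ := exists_orthonormal_screen (V := E) B hBs hBpos hT' hℓ0' hℓ
  -- `g(ℓ, T) ≠ 0`
  have hα : B T ℓ ≠ 0 := fun h ↦ by
    have := hBpos T ℓ hT' h hℓ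
    rw [hℓ0'] at this
    exact lt_irrefl 0 this
  -- the transverse null vector
  set a : ℝ := -(B T ℓ)⁻¹ with ha
  set b : ℝ := -(a * B T T) / (2 * B T ℓ) with hb
  set N : E := a • T + b • ℓ with hN
  have hℓN : B ℓ N = -1 := by
    simp only [hN, map_add, map_smul, smul_eq_mul, hBs ℓ T, hℓ0', mul_zero, add_zero, ha]
    field_simp
  have hNN : B N N = 0 := by
    simp only [hN, map_add, map_smul, _root_.add_apply, _root_.smul_apply, smul_eq_mul,
      hBs ℓ T, hℓ0', mul_zero, add_zero]
    rw [hb]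
    field_simp
    ring
  have heN : ∀ i, B (e i) N = 0 := fun i ↦ by
    simp only [hN, map_add, map_smul, smul_eq_mul, heT i, heℓ i, mul_zero, add_zero]
  refine ⟨⟨ℓ, N, e, hℓ0, ?_, ?_, ?_, ?_, ?_⟩, rfl⟩
  · rw [← hB]; exact hNN
  · rw [← hB]; exact hℓN
  · intro i; rw [← hB]; exact heℓ i
  · intro i; rw [← hB]; exact heN i
  · intro i j; rw [← hB]; exact heon i j

end NullConeFrame

end Cone

end Literature.Geometry.Lorentzian

end
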